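import Summits.BirchSwinnertonDyer.BirchSwinnertonDyer.Theorems.ThetaPartnerAtTwoSignedMainConjectureCMTwoRankZeroOfHonda
import Literature.NumberTheory.EllipticCurves.Sprung2017.ChromaticLimitCongruenceProofs
import HarnessLib

/-!
# Route `ThetaPartnerAtTwo` (TP2), crux K2r0 `SignedMainConjectureCMTwoRankZero` (stmt-BirchSwinnertonDyer-20312),
# line `rankzero` v11: the load-bearing global stub may be taken ONE-SIDED — the Eisenstein (lower) divisibility of
# Kobayashi's `+` main conjecture at `2` MODULO POWERS OF `2` — because analytic `μ = 0` lifts it to the integral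
# Eisenstein half `KobayashiLowerDivisibility A 2 1`

HONEST FRAMING (cell `pub/bsd-wall`, W-ALL row 1, lead prover `bsd-wall-tp2-p2` g5). Nothing here is the crux; the crux
(Kobayashi's `+` main conjecture at `2` with `μ⁺ = 0` for CM curves of analytic rank `0`, i.e. Pollack–Rubin 2004 Thm. 7.3
read at the inert prime `2`) is NOT in print and NOT proved here. WHAT THIS FILE ADDS to v10 (p587266 `…RankZeroUpToTwoPower`,
p588365 `…RankZeroOfHonda`): v10's global research stub (MC±2^k)_A is TWO-sided («`char X⁺ = (g)` with
`2^{m'}·ι g = 2^m·ϖ·ι L♭`», i.e. the main conjecture in `Λ ⊗ ℚ₂`). The rank-0 rigidity that makes «modulo powers of 2»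
harmless needs only the LOWER half: if `char X⁺ = (g)` and `2^{m'}·ι g = 2^m·ϖ·ι(L♭·h)` for SOME cofactor `h ∈ Λ`, then,
because `ϖ` is a `2`-adic unit (Abbes–Ullmo / the tree's `realPeriodRat_eq_unit_mul_plusPeriod_two`) and `L♭ ∉ 2Λ` (the analytic
`μ = 0` stub, already a binder of the line), prime avoidance in `Λ = ℤ₂⟦T⟧` (`𝔽₂⟦T⟧` is a domain) forces `2^{m'−m} ∣ h`, so
`ι g = ϖ·ι(L♭·k)` with `k ∈ Λ` — EXACTLY `KobayashiLowerDivisibility A 2 1`, the (E)_A of g1's line v7, which p585652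
(`signedMainConjectureCMTwoRankZero_at_of_local`) already turns into the crux at `A` together with the local theory and print.
The one-sided statement is implied by v10's two-sided one (`h = 1`) and NOT conversely as algebra (the Euler-system = UPPER half
`2^{m'}·ι(g·h) = 2^m·ϖ·ι L♭` does NOT suffice: `g = 2`, `L♭ = T − 2` has matching constant-term valuations and `μ(L♭) = 0`,
yet `(g) ≠ (L♭)`), so the registered stub of v11 is STRICTLY WEAKER than v10's.

* §1 (pure `Λ`-algebra) `not_C_two_dvd_of_exists_isUnit_coeff`, `C_two_pow_dvd_of_C_two_pow_mul_eq` (prime avoidance: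
  `2^r·g = c·L·h`, `c ∈ ℤ₂ˣ`, `2 ∤ L` ⇒ `2^r ∣ h`), `exists_eq_C_mul_of_lowerUpToTwoPower` (the lift
  `2^{m'}·ι g = 2^m·ϖ·ι(L·h)` ⇒ `ι g = ϖ·ι(L·k)`).
* §2 `kobayashiLowerDivisibility_two_one_of_lowerUpToTwoPower_of_flat` — CM-free: any `A` good supersingular at `2`, granted the
  period fact: (LD±2^k)_A + (μ♭)_A ⇒ `KobayashiLowerDivisibility A 2 1`.
* §3 `signedMainConjectureCMTwoRankZero_at_of_honda_of_lowerUpToTwoPower` — the v11 composition door: HONDA⁺@2(A) + PUB +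
  (LD±2^k)_A + (μ♭)_A ⇒ both conjuncts of the crux AT `A` (through p588365 §1 and p585652 §6).
Nothing about any curve is asserted; every research input is a displayed binder; BSD is not proved by any of this.

References: [PollackRubin2004] Thm. 7.3 (p > 2); [Kobayashi2003] Conjecture (p. 2), Thm. 1.2; [BurungaleFlach2024] Thm. 1.1,
Remark 7; [AbbesUllmo1996] Thm. A; [Lang1990] Ch. 5 §1 (prime avoidance in `Λ`); [Washington1997] §7.1.
-/

set_option autoImplicit false
-- the Theorems namespace of this sub repeats the summit name by design (D-0017 nested layout)
set_option linter.dupNamespace false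

noncomputable section

open scoped Classical NumberField MatrixGroups ModularForm

open NumberField IsDedekindDomain CongruenceSubgroup

namespace Summit.BirchSwinnertonDyer.BirchSwinnertonDyer.Theorems

open Literature.NumberTheory.EllipticCurves Literature.NumberTheory.GaloisRepresentations
  WeierstrassCurve ZpExtension Literature.NumberTheory.EllipticCurves.Kobayashi2003
  Literature.NumberTheory.EllipticCurves.IwasawaDual Literature.NumberTheory.EllipticCurves.GreenbergVatsal2000
  Literature.NumberTheory.EllipticCurves.ModularForms Literature.NumberTheory.EllipticCurves.Rank1Residual
  Literature.NumberTheory.EllipticCurves.Rank1Residual.Typed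
  Summit.BirchSwinnertonDyer.Rank1Residual Summit.BirchSwinnertonDyer.Rank1Residual.Supersingular

/-! ## §1. Prime avoidance in `Λ = ℤ₂⟦T⟧` and the lift of the one-sided congruence -/

section Algebra

/-- A power series over `ℤ₂` with a unit coefficient is not divisible by `2`. [folklore] -/
theorem not_C_two_dvd_of_exists_isUnit_coeff {L : IwasawaAlgebra 2}
    (h : ∃ n : ℕ, IsUnit (PowerSeries.coeff n L)) : ¬ PowerSeries.C (2 : ℤ_[2]) ∣ L := by
  rintro ⟨M, rfl⟩
  obtain ⟨n, hn⟩ := h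
  rw [PowerSeries.coeff_C_mul] at hn
  have h2 : IsUnit (2 : ℤ_[2]) := isUnit_of_mul_isUnit_left hn
  have hlt : ‖(2 : ℤ_[2])‖ < 1 := by
    have h := PadicInt.norm_p (p := 2)
    rw [show ((2 : ℕ) : ℤ_[2]) = 2 by norm_num] at h
    rw [h]
    norm_num
  exact absurd (PadicInt.isUnit_iff.mp h2) hlt.ne

/-- `2 ∣ G` in `ℤ₂⟦T⟧` iff the reduction of `G` modulo `2` vanishes (the tree's `C_prime_dvd_iff_map_toZMod_eq_zero` at
`p = 2`, with the literal `2`). [cite: Lang1990, Ch. 5 §1] -/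
theorem C_two_dvd_iff_map_toZMod_eq_zero (G : IwasawaAlgebra 2) :
    PowerSeries.C (2 : ℤ_[2]) ∣ G ↔ PowerSeries.map (PadicInt.toZMod (p := 2)) G = 0 := by
  have h := Sprung2017.C_prime_dvd_iff_map_toZMod_eq_zero (p := 2) G
  rwa [show ((2 : ℕ) : ℤ_[2]) = 2 by norm_num] at h

/-- **Prime avoidance in `Λ = ℤ₂⟦T⟧`**: if `2^r · g = c · L · h` with `c ∈ ℤ₂ˣ` and `2 ∤ L`, then `2^r ∣ h`
(`𝔽₂⟦T⟧` is a domain; induction on `r`). [cite: Lang1990, Ch. 5 §1] -/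
theorem C_two_pow_dvd_of_C_two_pow_mul_eq {c : ℤ_[2]} (hc : IsUnit c) {L : IwasawaAlgebra 2}
    (hL : ¬ PowerSeries.C (2 : ℤ_[2]) ∣ L) :
    ∀ (r : ℕ) (g h : IwasawaAlgebra 2), PowerSeries.C ((2 : ℤ_[2]) ^ r) * g = PowerSeries.C c * L * h →
      PowerSeries.C ((2 : ℤ_[2]) ^ r) ∣ h := by
  intro r
  induction r with
  | zero => intro g h _; exact ⟨h, by simp⟩
  | succ r ih =>
    intro g h H
    -- `2 ∣ c·L·h`, hence `2 ∣ h`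
    have h2 : PowerSeries.C (2 : ℤ_[2]) ∣ PowerSeries.C c * L * h :=
      ⟨PowerSeries.C ((2 : ℤ_[2]) ^ r) * g, by rw [← H, pow_succ, map_mul]; ring⟩
    have hh : PowerSeries.C (2 : ℤ_[2]) ∣ h := by
      rw [C_two_dvd_iff_map_toZMod_eq_zero] at h2 ⊢
      rw [map_mul, map_mul, PowerSeries.map_C] at h2
      have hcu : IsUnit (PowerSeries.C (PadicInt.toZMod (p := 2) c) : PowerSeries (ZMod 2)) :=
        PowerSeries.isUnit_iff_constantCoeff.mpr (by simpa using hc.map (PadicInt.toZMod (p := 2)))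
      have hLne : PowerSeries.map (PadicInt.toZMod (p := 2)) L ≠ 0 :=
        fun h0 ↦ hL ((C_two_dvd_iff_map_toZMod_eq_zero L).mpr h0)
      rcases mul_eq_zero.mp h2 with h12 | h3
      · rcases mul_eq_zero.mp h12 with h1 | h1
        · exact absurd h1 hcu.ne_zero
        · exact absurd h1 hLne
      · exact h3
    obtain ⟨h', rfl⟩ := hh
    -- cancel one `2`
    have H' : PowerSeries.C ((2 : ℤ_[2]) ^ r) * g = PowerSeries.C c * L * h' := by
      have h20 : (PowerSeries.C (2 : ℤ_[2]) : IwasawaAlgebra 2) ≠ 0 :=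
        (map_ne_zero_iff _ (PowerSeries.C_injective (R := ℤ_[2]))).mpr two_ne_zero
      apply mul_left_cancel₀ h20
      calc PowerSeries.C (2 : ℤ_[2]) * (PowerSeries.C ((2 : ℤ_[2]) ^ r) * g)
          = PowerSeries.C ((2 : ℤ_[2]) ^ (r + 1)) * g := by rw [pow_succ, map_mul]; ring
        _ = PowerSeries.C c * L * (PowerSeries.C 2 * h') := H
        _ = PowerSeries.C (2 : ℤ_[2]) * (PowerSeries.C c * L * h') := by ring
    obtain ⟨k, rfl⟩ := ih g h' H'
    exact ⟨k, by rw [pow_succ, map_mul]; ring⟩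

/-- A rational number of `2`-adic valuation `0` is (the image of) a unit of `ℤ₂`. [folklore] -/
theorem exists_units_padicInt_coe_eq_of_padicValRat_eq_zero {ϖ : ℚ} (hϖ0 : ϖ ≠ 0) (hϖ : padicValRat 2 ϖ = 0) :
    ∃ c : ℤ_[2]ˣ, ((c : ℤ_[2]) : ℚ_[2]) = (ϖ : ℚ_[2]) := by
  have hnorm : ‖(ϖ : ℚ_[2])‖ = 1 := by
    rw [Padic.eq_padicNorm, padicNorm.eq_zpow_of_nonzero hϖ0, hϖ, neg_zero, zpow_zero, Rat.cast_one]
  refine ⟨PadicInt.mkUnits hnorm, ?_⟩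
  simp [PadicInt.mkUnits]

/-- **The lift.** In `ℚ₂⟦T⟧`: if `2^{m'}·ι g = 2^m·ϖ·ι(L·h)` with `g, L, h ∈ Λ`, `ϖ ∈ ℚˣ` a `2`-adic unit and `L ∉ 2Λ`
(a unit coefficient), then `ι g = ϖ·ι(L·k)` for some `k ∈ Λ`. [cite: Lang1990, Ch. 5 §1] -/
theorem exists_eq_C_mul_of_lowerUpToTwoPower {g h L : IwasawaAlgebra 2} {ϖ : ℚ} (hϖ0 : ϖ ≠ 0)
    (hϖ : padicValRat 2 ϖ = 0) (hL : ∃ n : ℕ, IsUnit (PowerSeries.coeff n L)) {m m' : ℕ}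
    (H : PowerSeries.C ((2 : ℚ_[2]) ^ m') * iwasawaToPowerSeries 2 g =
      PowerSeries.C ((2 : ℚ_[2]) ^ m * (ϖ : ℚ_[2])) * iwasawaToPowerSeries 2 (L * h)) :
    ∃ k : IwasawaAlgebra 2, iwasawaToPowerSeries 2 g =
      PowerSeries.C (ϖ : ℚ_[2]) * iwasawaToPowerSeries 2 (L * k) := by
  have h20 : (2 : ℚ_[2]) ≠ 0 := two_ne_zero
  have hCne : ∀ j : ℕ, (PowerSeries.C ((2 : ℚ_[2]) ^ j) : PowerSeries ℚ_[2]) ≠ 0 := fun j ↦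
    (map_ne_zero_iff _ (PowerSeries.C_injective (R := ℚ_[2]))).mpr (pow_ne_zero _ h20)
  have hιC : ∀ j : ℕ, iwasawaToPowerSeries 2 (PowerSeries.C ((2 : ℤ_[2]) ^ j)) = PowerSeries.C ((2 : ℚ_[2]) ^ j) := by
    intro j
    rw [PowerSeries.map_C, map_pow, map_ofNat]
  rcases le_or_gt m' m with hle | hlt
  · -- `m' ≤ m`: divide by `2^{m'}`
    obtain ⟨r, rfl⟩ := Nat.exists_eq_add_of_le hle
    refine ⟨PowerSeries.C ((2 : ℤ_[2]) ^ r) * h, ?_⟩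
    apply mul_left_cancel₀ (hCne m')
    rw [H]
    simp only [map_mul, hιC, pow_add]
    ring
  · -- `m < m'`: `2^r · g = c · L · h` in `Λ`, prime avoidance
    obtain ⟨r, rfl⟩ := Nat.exists_eq_add_of_lt hlt
    obtain ⟨c, hc⟩ := exists_units_padicInt_coe_eq_of_padicValRat_eq_zero hϖ0 hϖ
    have hιc : iwasawaToPowerSeries 2 (PowerSeries.C (c : ℤ_[2])) = PowerSeries.C (ϖ : ℚ_[2]) := by
      rw [PowerSeries.map_C, ← hc]
      rfl
    -- the identity in `Λ`
    have HΛ : PowerSeries.C ((2 : ℤ_[2]) ^ (r + 1)) * g = PowerSeries.C (c : ℤ_[2]) * L * h := by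
      apply iwasawaToPowerSeries_injective 2
      apply mul_left_cancel₀ (hCne m)
      have H' := H
      simp only [map_mul, pow_add, pow_succ] at H'
      have hι2 : iwasawaToPowerSeries 2 (PowerSeries.C (2 : ℤ_[2])) = PowerSeries.C (2 : ℚ_[2]) := by
        rw [PowerSeries.map_C, map_ofNat]
      simp only [map_mul, hιC, hιc, hι2, pow_succ]
      linear_combination H'
    obtain ⟨k, rfl⟩ := C_two_pow_dvd_of_C_two_pow_mul_eq c.isUnit (not_C_two_dvd_of_exists_isUnit_coeff hL)
      (r + 1) g h HΛ
    refine ⟨k, ?_⟩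
    have hg : g = PowerSeries.C (c : ℤ_[2]) * L * k := by
      have hC0 : (PowerSeries.C ((2 : ℤ_[2]) ^ (r + 1)) : IwasawaAlgebra 2) ≠ 0 :=
        (map_ne_zero_iff _ (PowerSeries.C_injective (R := ℤ_[2]))).mpr (pow_ne_zero _ two_ne_zero)
      apply mul_left_cancel₀ hC0
      rw [HΛ]
      ring
    rw [hg]
    simp only [map_mul, hιc]
    ring

end Algebra

variable (A : WeierstrassCurve ℚ) [A.IsElliptic] [A.IsGloballyMinimal]

/-! ## §2. (LD±2^k)_A + (μ♭)_A ⇒ the integral Eisenstein half `KobayashiLowerDivisibility A 2 1` -/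

/-- The period ratio `ϖ` (`ϖ·Ω_A = Ω⁺_f`) is non-zero, granted the period fact at `2`. [cite: AbbesUllmo1996, Thm. A] -/
theorem periodRatio_ne_zero_two (h2 : Literature.NumberTheory.EllipticCurves.realPeriodRat_eq_unit_mul_plusPeriod_two)
    (hss : GoodSS A 2) {N : ℕ} [NeZero N] {f : CuspForm (Gamma0 N) 2} (hf : IsNewformOf A f)
    {ϖ : ℚ} (hϖ : (ϖ : ℝ) * A.realPeriodRat = plusPeriod f) : ϖ ≠ 0 := by
  obtain ⟨u, hu1, hΩ⟩ := h2 A hss.1 (P2.irr_two_of_goodSS_two A hss) f hf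
  have hΩpos : 0 < A.realPeriodRat := A.realPeriodRat_pos_holds
  rintro rfl
  rw [Rat.cast_zero, zero_mul] at hϖ
  rw [← hϖ, mul_zero] at hΩ
  exact hΩpos.ne' hΩ

/-- **(LD±2^k)_A + (μ♭)_A ⇒ `KobayashiLowerDivisibility A 2 1`.** `A/ℚ` globally minimal, good supersingular at `2`; grant the
period fact at `2` (`h2`, Abbes–Ullmo). IF at every normalised cyclotomic datum `char X⁺ = (g)` with the ONE-SIDED congruence
`2^{m'}·ι g = 2^m·ϖ·ι(L♭·h)` for some `h ∈ Λ`, `m, m' ∈ ℕ` (`hlow`), and Kobayashi's `L⁺ = L♭` has a unit coefficient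
(`hflat`), THEN the integral Eisenstein half holds: `ι g = ϖ·ι(L♭·k)`, `k ∈ Λ` (§1). No CM, no rank hypothesis.
[cite: Kobayashi2003, Conjecture (p. 2)] [cite: AbbesUllmo1996, Thm. A] -/
theorem kobayashiLowerDivisibility_two_one_of_lowerUpToTwoPower_of_flat
    (h2 : Literature.NumberTheory.EllipticCurves.realPeriodRat_eq_unit_mul_plusPeriod_two) (hss : GoodSS A 2)
    (hlow : ∀ (κ : ZpExtension ℚ 2) (γ : Field.absoluteGaloisGroup ℚ),
      κ.IsCyclotomic → κ.IsTopGenerator γ → IsCyclotomicVariable 2 γ →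
      ∀ [NeZero (A.conductorNorm ℤ)] (f : CuspForm (Gamma0 (A.conductorNorm ℤ)) 2),
        IsNewformOf A f → ∀ (ϖ : ℚ), (ϖ : ℝ) * A.realPeriodRat = plusPeriod f →
      ∀ (Lplus Lminus : IwasawaAlgebra 2), IsPollackPair f 2 Lplus Lminus →
      ∀ (D : SignedSelmerDualData A κ γ 1),
        ∃ (g h : IwasawaAlgebra 2) (m m' : ℕ), D.charIdeal = Ideal.span {g} ∧
          PowerSeries.C ((2 : ℚ_[2]) ^ m') * iwasawaToPowerSeries 2 g =
            PowerSeries.C ((2 : ℚ_[2]) ^ m * (ϖ : ℚ_[2])) * iwasawaToPowerSeries 2 (kobayashiL 1 Lplus Lminus * h))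
    (hflat : ∀ [NeZero (A.conductorNorm ℤ)] (f : CuspForm (Gamma0 (A.conductorNorm ℤ)) 2),
      IsNewformOf A f → ∀ (Lplus Lminus : IwasawaAlgebra 2), IsPollackPair f 2 Lplus Lminus →
        ∃ n : ℕ, IsUnit (PowerSeries.coeff n (kobayashiL 1 Lplus Lminus))) :
    KobayashiLowerDivisibility A 2 1 := by
  intro κ γ hκ hγ hγ' _ f hf ϖ hϖ Lplus Lminus hPP D
  obtain ⟨g, h, m, m', hchar, H⟩ := hlow κ γ hκ hγ hγ' f hf ϖ hϖ Lplus Lminus hPP D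
  obtain ⟨k, hk⟩ := exists_eq_C_mul_of_lowerUpToTwoPower (periodRatio_ne_zero_two A h2 hss hf hϖ)
    (padicValRat_periodRatio_eq_zero_two A h2 hss hf hϖ) (hflat f hf Lplus Lminus hPP) H
  exact ⟨g, k, hchar, hk⟩

/-! ## §3. The v11 composition door: HONDA⁺@2(A) + PUB + (LD±2^k)_A + (μ♭)_A ⇒ the crux AT `A` -/

/-- **K2r0 AT `A` from HONDA⁺@2(A) + PUB + the ONE-SIDED (Eisenstein) `+` main conjecture modulo powers of `2` + analytic
`μ = 0`.** Same binders as `signedMainConjectureCMTwoRankZero_at_of_honda_of_upToTwoPower` (p588365) with the two-sided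
(MC±2^k)_A REPLACED by the weaker one-sided (LD±2^k)_A («`char X⁺ = (g)`, `2^{m'}·ι g = 2^m·ϖ·ι(L♭·h)` for some `h`»):
CYC⁺@2 / LOC⁺@2 from HONDA (p588365 §1), LEV0 outright, (E)_A = `KobayashiLowerDivisibility A 2 1` from §2, and the rest is
p585652 §6 (`signedMainConjectureCMTwoRankZero_at_of_local`). [cite: PollackRubin2004, Thm. 7.3 (p > 2)]
[cite: Kobayashi2003, Thm. 1.2, Conjecture (p. 2), §8.4] [cite: BurungaleFlach2024, Thm. 1.1 and Remark 7] [cite: GreenbergLNM1716, §4] -/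
theorem signedMainConjectureCMTwoRankZero_at_of_honda_of_lowerUpToTwoPower
    (hBF : bsdTriple_of_hasCM_of_L_one_ne_zero)
    (hmod : nonempty_modularParametrizationData) (hLrat : hasEntireLFunction_rat)
    (hGZK : rank_eq_analyticRank_of_analyticRank_le_one)
    (h2 : Literature.NumberTheory.EllipticCurves.realPeriodRat_eq_unit_mul_plusPeriod_two)
    (hC : Greenberg1999.casselsSurjectivity_H1Sigma ℚ)
    (h412 : Greenberg1999.prop412_noFiniteSubmodule_H1Sigma_of_rank_one)
    (hcork : Greenberg1999.h1Sigma_zpCorank_le_degree ℚ)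
    (hP108 : Greenberg1999.localQuotient_restriction_surjective ℚ)
    (hWL : Greenberg1999.h1SigmaInfty_rank_eq_one)
    (hcm : A.HasCM) (hr : A.analyticRank = 0) (hss : GoodSS A 2) (ha : A.frobeniusTrace 2 = 0)
    (hhonda : ∀ (κ : ZpExtension ℚ 2), κ.IsCyclotomic →
      ∀ (v : HeightOneSpectrum (𝓞 ℚ)), (2 : 𝓞 ℚ) ∈ v.asIdeal →
      ∃ d : ℕ → localPoints A (v.adicCompletion ℚ),
        (∀ m, d m ∈ localLayerPointsOfEmb κ (closureEmb (K := ℚ) (v.adicCompletion ℚ)) A m) ∧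
        (∀ m, localTraceOfEmb κ (closureEmb (K := ℚ) (v.adicCompletion ℚ)) A (m + 1) (m + 2) (d (m + 2)) = -d m) ∧
        (∀ m : ℕ, 1 ≤ m → ∀ P ∈ localLayerPointsOfEmb κ (closureEmb (K := ℚ) (v.adicCompletion ℚ)) A m,
          ∃ B ∈ AddSubgroup.closure (Set.range fun σ : Field.absoluteGaloisGroup (v.adicCompletion ℚ) ↦ σ • d m),
            ∃ P' ∈ localLayerPointsOfEmb κ (closureEmb (K := ℚ) (v.adicCompletion ℚ)) A (m - 1),
            ∃ R ∈ localLayerPointsOfEmb κ (closureEmb (K := ℚ) (v.adicCompletion ℚ)) A m, P = B + P' + 2 • R) ∧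
        (∀ P ∈ localLayerPointsOfEmb κ (closureEmb (K := ℚ) (v.adicCompletion ℚ)) A 0,
          ∃ a : ℤ, ∃ R ∈ localLayerPointsOfEmb κ (closureEmb (K := ℚ) (v.adicCompletion ℚ)) A 0, P = a • d 0 + 2 • R))
    (hlow : ∀ (κ : ZpExtension ℚ 2) (γ : Field.absoluteGaloisGroup ℚ),
      κ.IsCyclotomic → κ.IsTopGenerator γ → IsCyclotomicVariable 2 γ →
      ∀ [NeZero (A.conductorNorm ℤ)] (f : CuspForm (Gamma0 (A.conductorNorm ℤ)) 2),
        IsNewformOf A f → ∀ (ϖ : ℚ), (ϖ : ℝ) * A.realPeriodRat = plusPeriod f →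
      ∀ (Lplus Lminus : IwasawaAlgebra 2), IsPollackPair f 2 Lplus Lminus →
      ∀ (D : SignedSelmerDualData A κ γ 1),
        ∃ (g h : IwasawaAlgebra 2) (m m' : ℕ), D.charIdeal = Ideal.span {g} ∧
          PowerSeries.C ((2 : ℚ_[2]) ^ m') * iwasawaToPowerSeries 2 g =
            PowerSeries.C ((2 : ℚ_[2]) ^ m * (ϖ : ℚ_[2])) * iwasawaToPowerSeries 2 (kobayashiL 1 Lplus Lminus * h))
    (hflat : ∀ [NeZero (A.conductorNorm ℤ)] (f : CuspForm (Gamma0 (A.conductorNorm ℤ)) 2),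
      IsNewformOf A f → ∀ (Lplus Lminus : IwasawaAlgebra 2), IsPollackPair f 2 Lplus Lminus →
        ∃ n : ℕ, IsUnit (PowerSeries.coeff n (kobayashiL 1 Lplus Lminus))) :
    (∀ (κ : ZpExtension ℚ 2) (γ : Field.absoluteGaloisGroup ℚ), κ.IsCyclotomic → κ.IsTopGenerator γ →
      ∀ D : SignedSelmerDualData A κ γ 1, Module.IsTorsion (IwasawaAlgebra 2) D.X ∧ D.mu = 0) ∧
    KobayashiMainConjecture A 2 1 :=
  signedMainConjectureCMTwoRankZero_at_of_local A hBF hmod hLrat hGZK h2 hC h412 hcork hP108 hWL hcm hr hss ha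
    (localNonDivCMTwo_at (A := A)) (plusCyclicLayersCMTwo_at_of_honda hss hhonda) (plusLocKummerCMTwo_at_of_honda hss hhonda)
    (kobayashiLowerDivisibility_two_one_of_lowerUpToTwoPower_of_flat A h2 hss hlow hflat) hflat

end Summit.BirchSwinnertonDyer.BirchSwinnertonDyer.Theorems

end
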